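import Mathlib
import Summits.QuantumFields.YangMills.Theses.SlowBitWindow
import Summits.QuantumFields.YangMills.Theorems.FemtoTransferGapLevelsPos

/-!
# `SlowBitWindow.SubFemtoEntropyOfWindowTail` — the regime-split glue (LINE g11-B, ym-idea-4)

Closes the glue item of the split `SubFemtoEntropy ⇐ SubFemtoEntropyLaplaceWindow ∧ SubFemtoEntropyPolyTail`
(stmt-QuantumFields-23787): given `A`, take the window's `a` and `(q₁, β₁, L₁)`, the tail's `(q₂, β₂, L₂)` at
`(a, A)`; `q = max q₁ q₂`, `β₀ = max (max β₁ β₂) 1`, `L₀ = max L₁ L₂`; case split on `L ≤ β^a`;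
`β^{qᵢ} ≤ β^{q}` for `β ≥ 1` times `λ₀^L ≥ 0`. Pure logic; no summit content.
-/

set_option autoImplicit false

noncomputable section

open Summit.QuantumFields.YangMills.Theorems.FemtoTransferGap

namespace Summit.QuantumFields.YangMills.Theorems.SlowBitWindow

open Summit.QuantumFields.YangMills.Theses.SlowBitWindow

/-- Window ∧ tail ⇒ `SubFemtoEntropy` (the glue of the g11-B regime split). -/
theorem subFemtoEntropy_of_window_of_tail (hW : SubFemtoEntropyLaplaceWindow) (hP : SubFemtoEntropyPolyTail) :
    SubFemtoEntropy := by
  intro A hA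
  obtain ⟨a, ha, q₁, β₁, L₁, h₁⟩ := hW
  obtain ⟨q₂, β₂, L₂, h₂⟩ := hP a ha A hA
  refine ⟨max q₁ q₂, max (max β₁ β₂) 1, max L₁ L₂, ?_⟩
  intro β hβ L _ hL hLA
  have hβ1 : 1 ≤ β := le_trans (le_max_right _ _) hβ
  have hβ₁ : β₁ ≤ β := le_trans (le_trans (le_max_left _ _) (le_max_left _ _)) hβ
  have hβ₂ : β₂ ≤ β := le_trans (le_trans (le_max_right _ _) (le_max_left _ _)) hβ
  have hL₁ : L₁ ≤ L := le_trans (le_max_left _ _) hL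
  have hL₂ : L₂ ≤ L := le_trans (le_max_right _ _) hL
  have hlam : 0 ≤ levelValue su2Rep L β 0 ^ L :=
    pow_nonneg (levelValue_su2Rep_pos (by linarith) 0).le _
  have key : ∀ q' : ℝ, q' ≤ max q₁ q₂ →
      TT.physTrace L β L ≤ β ^ q' * levelValue su2Rep L β 0 ^ L →
      TT.physTrace L β L ≤ β ^ (max q₁ q₂) * levelValue su2Rep L β 0 ^ L := by
    intro q' hq' h
    refine le_trans h (mul_le_mul_of_nonneg_right ?_ hlam)
    exact Real.rpow_le_rpow_of_exponent_le hβ1 hq'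
  rcases le_total (L : ℝ) (β ^ a) with hLa | hLa
  · exact key q₁ (le_max_left _ _) (h₁ β hβ₁ L hL₁ hLa)
  · exact key q₂ (le_max_right _ _) (h₂ β hβ₂ L hL₂ hLa hLA)

/-- The glue item `SubFemtoEntropyOfWindowTail` (stmt-QuantumFields-23787) holds. -/
theorem subFemtoEntropyOfWindowTail : SubFemtoEntropyOfWindowTail :=
  fun hW hP => subFemtoEntropy_of_window_of_tail hW hP

end Summit.QuantumFields.YangMills.Theorems.SlowBitWindow

end
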